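import Summits.SmoothPoincare4.SmoothPoincare4.Theorems.DottedCircleRasmussenDcrGfgmw

/-!
# SmoothPoincare4 / DottedCircleRasmussen — `DcrGfgmw` is the model slice window (converse)

Item stmt-SmoothPoincare4-16153 (`DcrGfgmw`, the GFGMW window in the literal `S⁴`) is landed
CONDITIONALLY on MMSW Lemma 8.19 in the model (`DcrGfgmw_of_mmsw819` in
`Theorems/DottedCircleRasmussenDcrGfgmw.lean`, hypothesis
`MMSW.sMinus_nonpos_of_isModelSliceDisc`).  This file proves the CONVERSE reductions, which pin
down exactly what an unconditional proof of the item has to contain: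

* `DcrGfgmw.modelWindow` — `DcrGfgmw` implies the two-sided model window: a knot with MMSW
  invariants that bounds a model slice disc (`MMSW.IsModelSliceDisc`, a smooth proper disc in
  `ℝ⁴ ∖ D_k`) has `s₋ ≤ 0 ≤ s₊` (embed `ℝ⁴ ↪ S⁴` by an inverse stereographic chart,
  `isSmoothEmbedding_stereographic'_symm`);
* `DcrGfgmw.mmsw819_of_exists` — together with the two EXISTENCE facts of the invariant (general
  position `MMSW.exists_isModelIsotopic_wC_ne_zero`, Hirsch; eventual constancy of the finite
  approximations `MMSW.eventually_approxHasRasmussen`, MMSW Thm. 1.4) `DcrGfgmw` gives back the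
  named fact `MMSW.sMinus_nonpos_of_isModelSliceDisc` (MMSW Lemma 8.19 for discs, model form);
* `DcrGfgmw_iff_mmsw819` — hence, over the tree and modulo those existence facts, the item is
  EQUIVALENT to MMSW Lemma 8.19 for discs.  Closing it unconditionally means formalising
  Khovanov–Lee homology in `#ʳ(S¹ × S²)` (Rozansky, Willis, MMSW §§2–4: finite approximation,
  naturality, cobordism maps, `s(F_p) = 1 - 2p`), none of which is in the tree (even Lee's
  rank-two theorem for knots in `S³` is a named fact here, `GaussDiagram.finrank_leeHomologyZero_eq_two`).

References: Manolescu–Marengon–Sarkar–Willis, Duke Math. J. 172 (2023), Lemma 8.19, Thm. 1.4,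
Def. 8.1 [ManolescuMarengonSarkarWillis2023]; Freedman–Gompf–Morrison–Walker, Quantum Topol. 1
(2010), §1 [FreedmanGompfMorrisonWalker2010].
-/

-- the registered namespace `Summit.SmoothPoincare4.SmoothPoincare4.Theorems` repeats a component
set_option linter.dupNamespace false

open scoped Manifold ContDiff Topology
open Function Set Metric Module
open Literature.Topology.FourManifolds Literature.Topology.FourManifolds.MMSW

noncomputable section

namespace Summit.SmoothPoincare4.SmoothPoincare4.Theorems

namespace DcrGfgmw

/-- **A model slice disc is a slice datum in any 4-manifold containing `ℝ⁴`.** If `f` is a model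
slice disc for `K ⊂ ∂D_k` (a smooth proper disc in `ℝ⁴ ∖ D_k`) and `J : ℝ⁴ → X` is a smooth
embedding into a smooth 4-manifold, then `(J, J ∘ f)` is a slice datum for `K` in `X` in the sense
of `MMSW.IsSliceDiscInComplement` (the model case `e = id`, `isSliceDiscInComplement_id_iff`,
transported along `J`, `isSliceDiscInComplement_comp`). [folklore] -/
theorem isSliceDiscInComplement_of_isModelSliceDisc {X : Type*} [TopologicalSpace X]
    [ChartedSpace (EuclideanSpace ℝ (Fin 4)) X] [IsManifold (𝓡 4) ∞ X] {k : ℕ}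
    {K : (Metric.sphere (0 : EuclideanSpace ℝ (Fin 2)) 1) → EuclideanSpace ℝ (Fin 4)}
    {f : EuclideanSpace ℝ (Fin 2) → EuclideanSpace ℝ (Fin 4)} (hf : IsModelSliceDisc k K f)
    {J : EuclideanSpace ℝ (Fin 4) → X} (hJ : Manifold.IsSmoothEmbedding (𝓡 4) (𝓡 4) ∞ J) :
    IsSliceDiscInComplement k K X J (J ∘ f) :=
  isSliceDiscInComplement_comp ((isSliceDiscInComplement_id_iff K f).2 hf) hJ

/-- **`DcrGfgmw` implies the model slice window.** If the GFGMW window holds in the literal `S⁴`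
(the route decl `DcrGfgmw`), then every model knot `K ⊂ ∂D_k` with Manolescu–Marengon–Sarkar–Willis
invariants `w = (s₋, s₊)` that bounds a model slice disc in `ℝ⁴ ∖ D_k` satisfies `s₋ ≤ 0 ≤ s₊`:
embed the model disc into `S⁴` by the inverse stereographic chart `σᵥ⁻¹ : ℝ⁴ ↪ S⁴` from the pole
`v = e₀` (a smooth embedding, `isSmoothEmbedding_stereographic'_symm`;
`isSliceDiscInComplement_of_isModelSliceDisc`) and apply the window.  This is the converse of the
direction used in `DcrGfgmw_of_mmsw819` (Palais transfer), so the item is exactly the two-sided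
model window. [cite: ManolescuMarengonSarkarWillis2023, Lemma 8.19] -/
theorem modelWindow
    (h : Summit.SmoothPoincare4.SmoothPoincare4.Theses.DottedCircleRasmussen.DcrGfgmw) {k : ℕ}
    {K : (Metric.sphere (0 : EuclideanSpace ℝ (Fin 2)) 1) → EuclideanSpace ℝ (Fin 4)}
    (w : MMSWRasmussen k K) {f : EuclideanSpace ℝ (Fin 2) → EuclideanSpace ℝ (Fin 4)}
    (hf : IsModelSliceDisc k K f) : w.sMinus ≤ 0 ∧ 0 ≤ w.sPlus := by
  haveI : Fact (finrank ℝ (EuclideanSpace ℝ (Fin (4 + 1))) = 4 + 1) := ⟨finrank_euclideanSpace_fin⟩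
  have hv : (EuclideanSpace.single (0 : Fin 5) (1 : ℝ)) ∈
      Metric.sphere (0 : EuclideanSpace ℝ (Fin 5)) 1 := by
    simp
  exact h k K _ _ (isSliceDiscInComplement_of_isModelSliceDisc hf
    (isSmoothEmbedding_stereographic'_symm (n := 4) ⟨_, hv⟩)) w

/-- **`DcrGfgmw` gives back MMSW Lemma 8.19 for discs (model form), given existence of the
invariants.** Assume the two existence facts behind `s₋`/`s₊` — general position of model knots
off the core circles (`MMSW.exists_isModelIsotopic_wC_ne_zero`, Hirsch) and eventual constancy of
the Rasmussen invariants of the finite approximations (`MMSW.eventually_approxHasRasmussen`, MMSW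
Thm. 1.4).  Then the route decl `DcrGfgmw` implies the named fact
`MMSW.sMinus_nonpos_of_isModelSliceDisc`: given `s₋(K) = s` and a model slice disc, pick `s₊(K)`
(`MMSW.exists_hasSPlus`), bundle both as `w : MMSWRasmussen k K` and read `s ≤ 0` off the model
window (`modelWindow`).  CONDITIONAL on `hgp`, `hev` (named facts).
[cite: ManolescuMarengonSarkarWillis2023, Lemma 8.19 and Thm. 1.4] -/
theorem mmsw819_of_exists (hgp : exists_isModelIsotopic_wC_ne_zero)
    (hev : eventually_approxHasRasmussen)
    (h : Summit.SmoothPoincare4.SmoothPoincare4.Theses.DottedCircleRasmussen.DcrGfgmw) :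
    sMinus_nonpos_of_isModelSliceDisc := by
  intro r K s f hs hf
  obtain ⟨s', hs'⟩ := exists_hasSPlus hgp hev hs.isModelKnot hs.isNullHomologous
  exact (modelWindow h ⟨s, s', hs, hs'⟩ hf).1

end DcrGfgmw

/-- **The item `DcrGfgmw` is MMSW Lemma 8.19 for discs, over the tree.** Modulo the existence facts
of the invariant (`MMSW.exists_isModelIsotopic_wC_ne_zero`, `MMSW.eventually_approxHasRasmussen`),
the GFGMW window in the literal `S⁴` (route decl `DcrGfgmw`, item stmt-SmoothPoincare4-16153) is
EQUIVALENT to the named fact `MMSW.sMinus_nonpos_of_isModelSliceDisc` (MMSW Lemma 8.19 with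
`ℓ = σ = 1`, `g = 0`, in the model): `→` is `DcrGfgmw.mmsw819_of_exists` (inverse stereographic
embedding), `←` is `DcrGfgmw_of_mmsw819` (Palais transfer + general position, proved in
`Theorems/DottedCircleRasmussenDcrGfgmw.lean`).  Consequently an unconditional proof of the item is
an in-tree proof of MMSW Lemma 8.19, i.e. of Khovanov–Lee homology in `#ʳ(S¹ × S²)` with its
cobordism maps — not in the tree; the item closes the day that fact is discharged, or verbatim by
`DcrGfgmw_of_mmsw819` if it is restated with the fact as hypothesis.  CONDITIONAL on `hgp`, `hev`.
[cite: ManolescuMarengonSarkarWillis2023, Lemma 8.19 and Thm. 1.4] [cite: FreedmanGompfMorrisonWalker2010, §1] -/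
theorem DcrGfgmw_iff_mmsw819 (hgp : Literature.Topology.FourManifolds.MMSW.exists_isModelIsotopic_wC_ne_zero)
    (hev : Literature.Topology.FourManifolds.MMSW.eventually_approxHasRasmussen) :
    Summit.SmoothPoincare4.SmoothPoincare4.Theses.DottedCircleRasmussen.DcrGfgmw ↔
      Literature.Topology.FourManifolds.MMSW.sMinus_nonpos_of_isModelSliceDisc :=
  ⟨DcrGfgmw.mmsw819_of_exists hgp hev, DcrGfgmw_of_mmsw819⟩

end Summit.SmoothPoincare4.SmoothPoincare4.Theorems

end
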